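import Literature.Geometry.Symplectic.PlanarContactBoundary
import Literature.Geometry.Symplectic.AkbulutMatveyev
import Literature.Topology.FourManifolds.Gluing
import Literature.Topology.FourManifolds.SmoothOrientation
import HarnessLib

/-!
# Baykur's Kähler decomposition theorem: every closed oriented smooth 4-manifold is a union of
# two compact Stein domains whose Stein structures agree on the common contact boundary

Topic `Literature/Geometry/Symplectic`; namespace `Literature.Geometry.Symplectic`.  One NAMED FACT
(D-0014), the input the planners of route `SmoothPoincare4/ConvexBisection` asked provers to vendor
for the support item `SteinBisectionExists` (stmt-SmoothPoincare4-10509: every homotopy 4-sphere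
admits a Stein bisection along a common contact seam), and the existence half of the dictionary
behind its crux `AcyclicBisectionExists` (stmt-SmoothPoincare4-10508).

## Source (held text, read by the filing prover)

R. İ. Baykur, *Kähler decomposition of 4-manifolds*, Algebr. Geom. Topol. **6** (2006) 1239–1265,
doi:10.2140/agt.2006.6.1239, arXiv:math/0601396, bib key `Baykur2006`:

* Theorem 5.1 (§5 "Decomposition theorem", p. 1252 = arXiv p. 12), verbatim: *"Let `X` be a closed
  oriented smooth 4-manifold.  Then `X` admits a decomposition into two codimension zero
  submanifolds `X₊` and `X₋`, such that `X₊` and `−X₋` are both compact Stein manifolds with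
  strictly pseudoconvex boundaries.  These Stein structures can be chosen so that the induced
  contact structures `ξ₊` on `∂X₊` and `ξ₋` on `−∂X₋` are isotopic.  Furthermore, there are PALFs
  on each piece such that the open book decompositions they induce on `∂X₊` and `−∂X₋` are
  compatible with `ξ₊` and `ξ₋`, respectively, and they coincide.  In short, all data match on the
  hypersurface `H = ∂X₊ = −∂X₋`."*
* Introduction, p. 1240 (arXiv p. 3): *"We decompose `X` into two exact Kähler manifolds with
  strictly pseudoconvex boundaries, up to orientation, such that contact structures on the common
  boundary induced by the maximal complex distributions are isotopic. … It was first shown by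
  Akbulut and Matveyev in [AM] that a closed oriented smooth 4-manifold `X` could always be
  decomposed into Stein pieces, but there was no particular information one could use to argue for
  matching the induced contact structures on the separating hypersurface.  Our proof follows an
  alternative way via open book decompositions, and we conclude that the Stein structures can be
  chosen to agree on the common contact boundary."*
* Proof (pp. 1252–1254): Lemma 1 (a handle decomposition `X = X₁ ∪ X₂`, `X₁` the 0-, 1-, 2-handles,
  `X₂` the 3-, 4-handles, each with an ALLOWABLE achiral Lefschetz fibration over `D²` — Harer /
  Akbulut–Ozbagci — stabilised à la Etnyre–Fuller until the two boundary open books coincide, the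
  binding kept connected); cap off to `f̂ : Y → S²`, split the base into discs `D₊ ⊃` positive and
  `D₋ ⊃` negative critical values by re-choosing arcs (conjugation / Hurwitz moves), undo the
  surgery: `X = X₊ ∪ X₋` with a PALF on `X₊` and on `−X₋` inducing the same open book on `H`;
  PALF with non-separating vanishing cycles ⇒ compact Stein with the contact structure supported
  by that open book (Akbulut–Ozbagci / Loi–Piergallini, via Eliashberg–Gompf Legendrian surgery);
  two contact structures supported by one open book are isotopic (Giroux).

## The Lean rendering

`baykur_kahlerDecomposition : Prop` — for every closed (compact, Hausdorff, second countable,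
boundaryless `C^∞` atlas on `ℝ⁴`), connected, orientable
(`Literature.Topology.FourManifolds.IsOrientable`) smooth 4-manifold `X` there are two compact `C^∞`
4-manifolds with boundary `W₁`, `W₂` (model `𝓡∂ 4`), Stein structures `S₁ : SteinStructure W₁`,
`S₂ : SteinStructure W₂` (`SteinDomain.lean`: integrable `J`, strictly `J`-convex `φ` with `∂W` its
regular maximal level set — a compact Stein manifold with strictly pseudoconvex boundary), boundary
data `b₁`, `b₂` (`Literature.Topology.FourManifolds.BoundaryData`: the boundary as an abstract
3-manifold with its embedding `incl` onto `∂Wᵢ`), and a diffeomorphism `ψ : b₁.carrier ≅ b₂.carrier`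
such that

* `X` **is the gluing `W₁ ∪_ψ W₂`** (`Literature.Topology.FourManifolds.IsBoundaryGluing b₁ b₂ ψ (𝓡 4) X`,
  `Gluing.lean`: smooth embeddings of `W₁`, `W₂` into `X` covering `X` and meeting exactly along
  `b₁.incl z ≡ b₂.incl (ψ z)`) — print's "decomposition into two codimension zero submanifolds
  `X₊` and `X₋`" with `H = ∂X₊ = −∂X₋`; and
* **the Stein structures agree on the common contact boundary**: for every `z`, the differential of
  `b₂.incl ∘ ψ` carries the `S₁`-complex tangencies pulled back to the abstract boundary
  (`boundaryPlaneField S₁.J b₁ z`, `PlanarContactBoundary.lean`) ONTO the `S₂`-complex tangencies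
  `contactPlane S₂.J (b₂.incl (ψ z))` (`SteinBoundaryContact.lean`) — i.e. under the identification
  of the two boundaries inside `X` the two fields of maximal complex tangencies `ξ₊`, `ξ₋` are THE
  SAME plane field on `H`.

Deviations from the printed wording, all within what the source proves:
1. "isotopic" is recorded in its pointwise consequence.  Isotopic contact structures `ξ₊ ≃ ξ₋'` on
   the closed 3-manifold `H` are related by Gray's stability theorem (Gray 1959; Geiges 2008,
   Thm. 2.2.2: a smooth path of contact structures on a closed manifold is induced by an isotopy
   `ψ_t`, `ψ_{t*} ξ₀ = ξ_t`) — so `ψ₁` is a diffeomorphism of `H` isotopic to the identity with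
   `dψ₁(ξ₊) = ξ₋'`; extending the isotopy over a collar of `H` in `X₋` (Hirsch 1976, §8.1) gives a
   self-diffeomorphism `Φ` of `X₋` with `Φ|_H = ψ₁`, and the transported Stein structure `Φ^* J₋`
   on `X₋` (tree: `SteinStructure.comap`, `SteinDomainDiffeomorph.lean`, proved) has complex
   tangencies `dψ₁⁻¹(ξ₋') = ξ₊` on `H`.  This is the author's own summary (p. 1240, quoted above:
   "the Stein structures can be chosen to agree on the common contact boundary"; Thm. 5.1: "all
   data match on the hypersurface").  Nothing weaker would serve the consumers, whose statements
   (`Summit.SmoothPoincare4.SmoothPoincare4.Theses.ConvexBisection.*`) ask for pointwise equality of the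
   pushed-forward complex tangencies; nothing stronger is claimed (no contact FORMS, co-orientations
   or Liouville data are matched).
2. The PALF / open-book clause ("Furthermore, …") is dropped — the tree has open books
   (`Literature.Geometry.Symplectic.OpenBook`) but no Lefschetz fibrations; a weakening.
   `-- TODO(general form)` below.
3. Orientation bookkeeping is invisible, exactly as in the sibling fact
   `Literature.Geometry.Symplectic.akbulut_matveyev` (`AkbulutMatveyev.lean`): `W₂` is the ABSTRACT
   manifold `X₋` and `S₂` a Stein structure on it (inducing the orientation of `−X₋`); the
   hypothesis `IsOrientable (𝓡 4) X` is print's "oriented" (an orientation is a free choice) and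
   is in fact forced by the conclusion (both pieces carry complex orientations and `ψ` preserves the
   contact orientations of the seam components).  `ConnectedSpace X` is extra and harmless (print's
   proof starts from a handle decomposition with one 0- and one 4-handle).
4. Hypotheses imply print's: compact + `T2` + second countable + `IsManifold (𝓡 4) ∞` is "closed
   smooth"; conclusions are print's or weaker (1–2).  The theorem is published with its proof
   (AGT 2006), uncontested, and re-proved in a different language by J. Breen, *Folded symplectic
   forms in contact topology*, arXiv:2311.16058, Thm. 1.6 (folded Weinstein structures exist on
   every closed oriented 4-manifold) and, one dimension up, by Honda–Huang, arXiv:1907.06025,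
   Thm. 1.1 + Prop. 2 (convex hypersurfaces `Σ⁴ ⊂ (M⁵, ξ)`, `Σ = R₊ ∪_Γ R₋`).

## Why it is a named fact and not a theorem here (the fact is XL)

A proof needs, beyond the debt already recorded under `akbulut_matveyev` (handle decompositions —
tree `Literature.Topology.FourManifolds.exists_twoHandlebody_closedGluing_of_rearrangement`, proved
modulo Milnor's rearrangement fact; Eliashberg–Gompf Legendrian surgery — tree facts
`Gompf1998_thm13_noTwoHandles`, `Gompf1998_thm13_twoHandles`): achiral / positive allowable
Lefschetz fibrations over `D²` with bounded fibres and their boundary open books (Harer;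
Akbulut–Ozbagci, Geom. Topol. 5 (2001), Thm. 5; Loi–Piergallini, Invent. Math. 143 (2001)),
Etnyre–Fuller stabilisation matching of two open books (IMRN 2006), the capping / base-splitting /
Hurwitz-move argument of pp. 1252–1253, Giroux's correspondence (contact structures supported by
one open book are isotopic), Gray stability and collars.  None of the Lefschetz-fibration
vocabulary exists in Mathlib or the tree (searched: `Lefschetz`, `PALF`, `vanishing cycle`,
`monodromy` — 0 declaration hits outside docstrings; open books: `OpenBook`, `OpenBook.Supports` in
`PlanarContactBoundary.lean`).  The crux line `Cruxes/AcyclicBisectionExists/Lines/modp-braid-orbits.lean`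
of the same route carries the homologically controlled version of this dictionary as its one open
stub (`stub_sortedModelOpenBook`) and names the same missing vocabulary.

## Contents

* `baykur_kahlerDecomposition` — the named fact.
* `baykur_kahlerDecomposition.isBoundaryRelation_glueRel` — the gluing relation of the fact relates
  boundary points only (proved).
* `akbulut_matveyev_of_baykur_kahlerDecomposition` — **proved**: the fact refines the sibling named
  fact `akbulut_matveyev` (Akbulut–Matveyev 1998, abstract: `X = W₁ ∪_∂ W₂` with both pieces Stein
  domains, no contact matching) — print, p. 1240: "It was first shown by Akbulut and Matveyev …".

## References

* R. İ. Baykur, *Kähler decomposition of 4-manifolds*, Algebr. Geom. Topol. 6 (2006) 1239–1265,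
  Thm. 5.1 and p. 1240. [Baykur2006]
* H. Geiges, *An Introduction to Contact Topology*, CUP (2008), Thm. 2.2.2 (Gray stability).
  [Geiges2008]
* M. W. Hirsch, *Differential Topology*, GTM 33 (1976), §8.1 (isotopy extension over collars),
  §8.2 (gluing). [HirschDT1976]
* S. Akbulut, R. Matveyev, *A convex decomposition theorem for 4-manifolds*, IMRN 1998, no. 7,
  371–381. [AkbulutMatveyev1998]
* J. B. Etnyre, *Lectures on open book decompositions and contact structures*, Clay Math. Proc. 5
  (2006), Thm. 4.6 / §4 (Giroux correspondence, stabilisation). [Etnyre2006]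
-/

noncomputable section

open scoped Manifold ContDiff
open Set Function

namespace Literature.Geometry.Symplectic

open Literature.Topology.FourManifolds

/-- **Baykur (2006), Kähler decomposition of closed oriented 4-manifolds** (Algebr. Geom. Topol. 6,
Thm. 5.1, read with p. 1240: "the Stein structures can be chosen to agree on the common contact
boundary").  Every closed (compact, Hausdorff, second countable, boundaryless `C^∞` atlas on `ℝ⁴`),
connected, orientable smooth 4-manifold `X` is a gluing `X = W₁ ∪_ψ W₂`
(`Literature.Topology.FourManifolds.IsBoundaryGluing`) of two compact `C^∞` 4-manifolds with
boundary carrying Stein structures `S₁`, `S₂` (print: `X₊` and `−X₋` are compact Stein manifolds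
with strictly pseudoconvex boundary), along a diffeomorphism `ψ : ∂W₁ ≅ ∂W₂` of boundary data under
which the two fields of maximal complex tangencies of the boundaries coincide pointwise: the
differential of `b₂.incl ∘ ψ` carries the `S₁`-induced boundary plane field
(`boundaryPlaneField S₁.J b₁`) onto the `S₂`-complex tangencies (`contactPlane S₂.J`) at every point
(print: "the induced contact structures `ξ₊` on `∂X₊` and `ξ₋` on `−∂X₋` are isotopic … all data
match on the hypersurface `H = ∂X₊ = −∂X₋`", made pointwise by Gray stability and a collar twist of
the second Stein structure, see the module docstring).  The PALF / common-open-book clause of the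
printed theorem is not recorded. [cite: Baykur2006, Thm. 5.1] -/
def baykur_kahlerDecomposition : Prop :=
  ∀ (X : Type) [TopologicalSpace X] [T2Space X] [SecondCountableTopology X] [CompactSpace X]
    [ConnectedSpace X] [ChartedSpace (EuclideanSpace ℝ (Fin 4)) X] [IsManifold (𝓡 4) ∞ X],
    IsOrientable (𝓡 4) X →
    ∃ (W₁ : Type) (_ : TopologicalSpace W₁) (_ : ChartedSpace (EuclideanHalfSpace 4) W₁)
      (_ : IsManifold (𝓡∂ 4) ∞ W₁) (_ : CompactSpace W₁)
      (W₂ : Type) (_ : TopologicalSpace W₂) (_ : ChartedSpace (EuclideanHalfSpace 4) W₂)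
      (_ : IsManifold (𝓡∂ 4) ∞ W₂) (_ : CompactSpace W₂)
      (S₁ : SteinStructure W₁) (S₂ : SteinStructure W₂)
      (b₁ : BoundaryData (𝓡∂ 4) W₁ (𝓡 3)) (b₂ : BoundaryData (𝓡∂ 4) W₂ (𝓡 3))
      (ψ : b₁.carrier ≃ₘ⟮𝓡 3, 𝓡 3⟯ b₂.carrier),
      (∀ z, Submodule.map (mfderiv (𝓡 3) (𝓡∂ 4) (b₂.incl ∘ ψ) z).toLinearMap
          (boundaryPlaneField S₁.J b₁ z) = contactPlane S₂.J (b₂.incl (ψ z))) ∧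
        IsBoundaryGluing b₁ b₂ ψ (𝓡 4) X
-- TODO(general form): Baykur 2006, Thm. 5.1 moreover gives positive allowable Lefschetz fibrations
-- over `D²` on `W₁ = X₊` and on `W₂ = −X₋` whose boundary open books coincide under `ψ` and support
-- the common contact structure (no Lefschetz-fibration vocabulary in the tree yet).

/-! ### API -/

/-- The gluing relation "`x = b₁.incl z` and `y = b₂.incl (ψ z)`" of a boundary gluing relates
boundary points to boundary points (`IsBoundaryRelation`, `AkbulutMatveyev.lean`). [folklore] -/
theorem isBoundaryRelation_glueRel {W₁ W₂ : Type} [TopologicalSpace W₁]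
    [ChartedSpace (EuclideanHalfSpace 4) W₁] [TopologicalSpace W₂]
    [ChartedSpace (EuclideanHalfSpace 4) W₂]
    (b₁ : BoundaryData (𝓡∂ 4) W₁ (𝓡 3)) (b₂ : BoundaryData (𝓡∂ 4) W₂ (𝓡 3))
    (ψ : b₁.carrier → b₂.carrier) :
    IsBoundaryRelation W₁ W₂ fun x y => ∃ z, x = b₁.incl z ∧ y = b₂.incl (ψ z) := by
  rintro x y ⟨z, rfl, rfl⟩
  exact ⟨b₁.incl_mem_boundary z, b₂.incl_mem_boundary (ψ z)⟩

/-- **Baykur's theorem refines Akbulut–Matveyev's** (print, p. 1240: "It was first shown by Akbulut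
and Matveyev … that a closed oriented smooth 4-manifold `X` could always be decomposed into Stein
pieces"): forgetting the contact matching, the boundary data and the gluing diffeomorphism, the
fact gives the sibling named fact `akbulut_matveyev` — both pieces are Stein domains
(`IsSteinDomain`), glued (`IsClosedGluing`) along a relation between boundary points
(`IsBoundaryRelation`). [cite: Baykur2006, Thm. 5.1] -/
theorem akbulut_matveyev_of_baykur_kahlerDecomposition (h : baykur_kahlerDecomposition) :
    akbulut_matveyev := by
  intro X _ _ _ _ _ _ _ hO
  obtain ⟨W₁, t₁, c₁, m₁, k₁, W₂, t₂, c₂, m₂, k₂, S₁, S₂, b₁, b₂, ψ, -, hglue⟩ := h X hO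
  refine ⟨W₁, W₂, t₁, c₁, m₁, k₁, t₂, c₂, m₂, k₂,
    fun x y => ∃ z, x = b₁.incl z ∧ y = b₂.incl (ψ z), ⟨S₁⟩, ⟨S₂⟩,
    isBoundaryRelation_glueRel b₁ b₂ ψ, ?_⟩
  exact hglue

end Literature.Geometry.Symplectic

end
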